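import Mathlib
import Summits.Ventures.HodgeRepro2.T6N5Hyp
import Summits.Ventures.HodgeRepro2.T6N5Toy

/-!
# T6N5HypToy — the N5 displays hold JOINTLY on the toy data (README §10.5(ii)(c)/(d) for T6N5Hyp)

Tier 6 (README §10), sub-step N5 (t6-p7).  For every display of `T6N5Hyp` a model instance on which it
holds, and the joint instance: the trivial side `N5Toy.toySide` satisfies `Hyp.BFGYYZ2025_Thm5_6` (with
`S = {toySide}`) and `Hyp.BFGYYZ2025_Rem5_7` (with the trivial local data), the trivial branch
`N5Toy.toyBranch` satisfies `Hyp.Hsieh2014mu_ThmA`, `Hyp.BurungaleHida2017_ThmB` and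
`Hyp.Hsieh2014mu_Interp1_1` at once (they are three of the fields of `N5Toy.toyBranch_hyps`), and the
constant ε = 1 on trivial carriers satisfies Tate's printed pair.  The carriers are non-empty (the
instances are exhibited), nothing is closed by `trivial` on the displays' parameters, and the
hypotheses of the assembly are jointly satisfiable (`N5Toy.toyFamily_N5`).  Nothing is claimed about the
actual datum.  §8(d): uses an L-value-free non-vanishing device: NO.
-/

namespace Summit.Ventures.HodgeRepro2.T6.N5HypToy

open Summit.Ventures.HodgeRepro2.T6.N5Skeleton Summit.Ventures.HodgeRepro2.T6.N5PropG
  Summit.Ventures.HodgeRepro2.T6.N5Toy Summit.Ventures.HodgeRepro2.T6.Hyp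

/-- Theorem 5.6's display holds on the singleton family of the trivial side. -/
theorem thm5_6_toy : BFGYYZ2025_Thm5_6 ({toySide} : Set (ToricSide Unit (Multiplicative ℤ))) := by
  intro X hX
  rw [Set.mem_singleton_iff] at hX
  rw [hX]
  exact toySide_dichotomy

/-- Remark 5.7's display holds on the trivial side with the trivial local data. -/
theorem rem5_7_toy : BFGYYZ2025_Rem5_7 toySide (fun _ => True) True :=
  ⟨fun _ _ => trivial, fun _ => ⟨fun _ => ⟨toySide_condA, toySide_condB⟩, fun _ _ => trivial⟩⟩

/-- Hsieh's Theorem A display holds on the trivial branch. -/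
theorem hsieh_toy : Hsieh2014mu_ThmA toyBranch := toyBranch_hyps.hsieh

/-- Burungale–Hida's Theorem B display holds on the trivial branch. -/
theorem bh_toy : BurungaleHida2017_ThmB toyBranch := toyBranch_hyps.bh

/-- Hsieh's interpolation display holds on the trivial branch. -/
theorem interp_toy : Hsieh2014mu_Interp1_1 toyBranch := toyBranch_hyps.interp

/-- Tate's printed pair holds for the constant ε = 1 on trivial carriers (every a is «non-zero»,
‖a‖ = 1, χ(a) = 1; the scaling law with r = 1 is the only scaling available on a one-point measure
carrier, so we take the scaling to act on ℝ by multiplication on ε's value: ε ≡ r on `sc r dx`). -/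
theorem tate_toy : Tate1979_3_2_2_3 (F := Unit) (Char := Unit) (Psi := Unit) (Meas := ℝ)
    (fun _ _ dx => (dx : ℂ)) (fun _ _ => 1) (fun ψ _ => ψ) (fun r dx => r * dx) (fun _ => 1)
    (fun _ => True) := by
  refine ⟨fun _ _ dx r _ => ?_, fun _ _ _ _ _ => ?_⟩
  · push_cast; ring
  · simp

/-- THE JOINT INSTANCE: all six displays hold simultaneously on the toy data, and the assembly's
conclusion is available there (`N5Toy.toyFamily_N5`). -/
theorem joint_toy :
    BFGYYZ2025_Thm5_6 ({toySide} : Set (ToricSide Unit (Multiplicative ℤ))) ∧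
    BFGYYZ2025_Rem5_7 toySide (fun _ => True) True ∧
    Hsieh2014mu_ThmA toyBranch ∧ BurungaleHida2017_ThmB toyBranch ∧
    Hsieh2014mu_Interp1_1 toyBranch ∧ ∃ ν, (toyFamily ν).N5 :=
  ⟨thm5_6_toy, rem5_7_toy, hsieh_toy, bh_toy, interp_toy, toyFamily_N5⟩

end Summit.Ventures.HodgeRepro2.T6.N5HypToy
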